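import Summits.QuantumFields.BalabanUV.T4Continuum.Support.NE7CombGenerator
import Summits.QuantumFields.BalabanUV.T4Continuum.Support.NE3AxialGaugeLadder
import Summits.QuantumFields.BalabanUV.T4Continuum.Support.BlockAverageLoopLogPrep
import Summits.QuantumFields.BalabanUV.T4Continuum.Support.NE3TangentNoGoWords
import HarnessLib

/-!
# NE7CoarseAxialPoincare — THE ADDITIVE AXIAL (tree) GAUGE ON A BOX AND ITS SUP-NORM POINCARÉ LEMMA: for a 1-form `φ` and a corner `q`, the TREE POTENTIAL
# `λ(y) = φ(Γ_{q,y})` (the sum of `φ` along [B7]'s tree word from `q` to `y`) satisfies, at every site `x = q + w` (`w ≥ 0`) and direction `κ`,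
# `φ(x,κ) − (λ(x+e_κ) − λ(x)) = Σ_{m<κ} Σ_{i<w_m} φ(∂p_{m,i})` — a LADDER of `Σ_{m<κ} w_m ≤ |w|₁` plaquette circulations inside the box `[q, x]` — hence
# `‖φ(x,κ) − dPot λ (x,κ)‖ ≤ |w|₁·G` whenever every plaquette circulation based in `[q, x]` is `≤ G`: a field with small curl on a box is a gradient plus
# `(box size)×(curl)`

Cell `pub-balaban`, rung (B)+1 sub-cell t4, lineage `b2b-balaban-t4-ne7-p1` (CRUX PROVER NE7 #1 = OWNER of row NE7), generation 89; memo
`t4/b2b-balaban-t4-ne7-p1-g89/COSTING-N1.md` §8 (β).  File F270 (over lit-balaban's `B7Prop1Explicit` (`asum`, `treeWord`, `asum_append`, `asum_plaqWord`, `asum_seg_natCast`),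
row NE3's `NE3AxialGaugeLadder.treeWord_add_of_separated`, F143 `NE7CombGenerator.asum_treeWord_add_e`, `BlockAverageLoopLogPrep.stair_stokes` (the staircase Stokes
identity, generic coefficients, read at `L = 1`), `NE3TangentNoGoWords.dPot`).

WHY (memo §8 (β)).  The v4 END (F263) wants the chart's linearised top average split as `D_1(χA_loc) = φ₁ + E` with the flat coarse curl of `φ₁` bounded GLOBALLY
by `ĝ` free of r-linear terms.  Cutting `D_1A_loc` off directly costs `(δχ̃)·D_1A_loc = O(r)`; cutting off its AXIAL REMAINDER `a = D_1A_loc − dλ` costs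
`(δχ̃)·a = O(ℓ′·ĝ₀∕ℓ′) = O(ĝ₀)`, `ĝ₀` the coarse curvature (β′ + quadratic).  THIS FILE is the lattice Poincaré lemma producing `λ` and bounding `a`.
WHAT ([folklore]; 0 def — the potential is the explicit term `fun y => asum φ q (treeWord (y − q))`; 0 sorry; generic `d`, coefficients `Matrix n n ℂ`).
§1 `treeWord_natCast_eq_stairWord`, `asum_seg_one`, `highPart ∕ lowPart` bookkeeping (as explicit `if`-vectors).
§2 **`sub_dPot_treePot_eq_stairSum`** — the ladder identity.
§3 **`norm_stairSum_one_le`** — `‖ladder‖ ≤ (Σ_{m∈ms} w_m)·G` under a plaquette bound on the box (induction on the staircase with the invariant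
   `p_i + [i ∈ ms]w_i ≤ x_i`).
§4 **`norm_sub_dPot_treePot_le`** — `‖φ(x,κ) − dPot λ (x,κ)‖ ≤ |w|₁·G` for `x = q + w`, `G` a bound of `‖φ(∂p)‖` over the plaquettes based in `[q, x]`.
HONEST FRAMING (page 1): lattice kinematics; nothing of Bałaban's asserted (context: the axial gauge of [Balaban1985Averaging] p. 24, [Balaban1985RegularSpaces]
Lemma 1 — the tree's `B8Lemma1Lattice` is the real-valued twin); NOT (APE), NOT ONE-STEP, NOT NE7; spine 0∕9; finite T⁴ rung (B)+1 — NOT infinite volume, NOT mass gap,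
NOT `BetaPertH`, NOT Clay.  Continuum YM on T⁴ ⇐ BetaPertH ∧ nine spine estimates (0/9 proved); BetaPertH ⇐ (D1) ∧ (D4) ∧ CAP+tail; G-an2-4 gates asym, D1 and NE2/3/4.
-/

set_option autoImplicit false

open scoped BigOperators Matrix.Norms.L2Operator
open NormedSpace Finset

namespace Summit.QuantumFields.BalabanUV.T4Continuum.NE7CoarseAxialPoincare

open Literature.MathematicalPhysics.QuantumFieldTheory.Balaban1983to89
open B7Prop1Explicit B7Prop2Explicit
open NE3TangentNoGoWords (dPot)
open NE3AxialGaugeLadder (treeWord_add_of_separated)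
open NE7CombGenerator (asum_treeWord_add_e)
open BlockAverageLoopLogPrep (stairWord stairSum stairSum_cons stairSum_nil stair_stokes)

noncomputable section

variable {d : ℕ} {n : Type*} [Fintype n] [DecidableEq n]

/-! ## §1 Bookkeeping -/

omit [Fintype n] [DecidableEq n] in
/-- The tree word of a non-negative integer vector is the staircase word over all axes in decreasing order. [folklore] -/
theorem treeWord_natCast_eq_stairWord (w : Fin d → ℕ) :
    treeWord (fun i => ((w i : ℕ) : ℤ)) = stairWord (d := d) w (List.finRange d).reverse := rfl

/-- `φ([y, y + e_κ]) = φ(y,κ)`. [folklore] -/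
theorem asum_seg_one (φ : Site d → Fin d → Matrix n n ℂ) (y : Site d) (κ : Fin d) : asum φ y (seg κ ((1 : ℕ) : ℤ)) = φ y κ := by
  rw [asum_seg_natCast]
  simp

/-! ## §2 The ladder identity -/

/-- **THE LADDER IDENTITY OF THE TREE POTENTIAL**: for `x = q + w` (`w ≥ 0`), with `u` = the part of `w` on the axes `≥ κ`, `v` = the part on the axes `< κ`,
`φ(x,κ) − (λ(x+e_κ) − λ(x)) = stairSum φ κ 1 v (q + u) (axes decreasing)`, `λ = φ(Γ_{q,·})`: the tree words to `x` and to `x + e_κ` share the high part, differ by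
the bond `(q+u, κ)` (F143 `asum_treeWord_add_e`), and their low staircases from `q+u` and `q+u+e_κ` differ by the staircase Stokes sum (`stair_stokes` at `L = 1`).
[folklore] -/
theorem sub_dPot_treePot_eq_stairSum (φ : Site d → Fin d → Matrix n n ℂ) (q : Site d) (w : Fin d → ℕ) (κ : Fin d) :
    φ (q + fun i => ((w i : ℕ) : ℤ)) κ
        - dPot (fun y : Site d => asum φ q (treeWord (y - q))) (q + fun i => ((w i : ℕ) : ℤ)) κ
      = stairSum φ κ 1 (fun i => if i < κ then w i else 0) (q + fun i => if κ ≤ i then ((w i : ℕ) : ℤ) else 0) (List.finRange d).reverse := by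
  -- the high and low parts
  set u : Site d := fun i => if κ ≤ i then ((w i : ℕ) : ℤ) else 0 with hu
  set lw : Fin d → ℕ := fun i => if i < κ then w i else 0 with hlw
  set v : Site d := fun i => ((lw i : ℕ) : ℤ) with hv
  have huv : (fun i => ((w i : ℕ) : ℤ)) = u + v := by
    funext i
    simp only [hu, hv, hlw, Pi.add_apply]
    by_cases h : κ ≤ i
    · rw [if_pos h, if_neg (not_lt.mpr h)]; simp
    · rw [if_neg h, if_pos (not_le.mp h)]; simp
  have hulow : ∀ i, i < κ → u i = 0 := fun i hi => by simp only [hu, if_neg (not_le.mpr hi)]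
  have hvhigh : ∀ i, κ ≤ i → v i = 0 := fun i hi => by simp only [hv, hlw, if_neg (not_lt.mpr hi)]; simp
  have hulow' : ∀ i, i < κ → (u + e κ) i = 0 := fun i hi => by
    rw [Pi.add_apply, hulow i hi, e_apply, if_neg (ne_of_lt hi)]; simp
  have huκ : 0 ≤ u κ := by simp only [hu, if_pos le_rfl]; positivity
  -- the two tree words
  have hT1 : treeWord (u + v) = treeWord u ++ treeWord v := (treeWord_add_of_separated κ hulow hvhigh).symm
  have hT2 : treeWord (u + e κ + v) = treeWord (u + e κ) ++ treeWord v := (treeWord_add_of_separated κ hulow' hvhigh).symm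
  have hpt1 : (q + fun i => ((w i : ℕ) : ℤ)) - q = u + v := by rw [huv]; abel
  have hpt2 : (q + fun i => ((w i : ℕ) : ℤ)) + e κ - q = u + e κ + v := by rw [huv]; abel
  -- the potential at the two points
  have hpot1 : asum φ q (treeWord ((q + fun i => ((w i : ℕ) : ℤ)) - q)) = asum φ q (treeWord u) + asum φ (q + u) (treeWord v) := by
    rw [hpt1, hT1, asum_append, disp_treeWord]
  have hpot2 : asum φ q (treeWord ((q + fun i => ((w i : ℕ) : ℤ)) + e κ - q))
      = asum φ q (treeWord u) + φ (q + u) κ + asum φ (q + u + e κ) (treeWord v) := by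
    rw [hpt2, hT2, asum_append, disp_treeWord, asum_treeWord_add_e φ q u κ hulow huκ, add_assoc q u (e κ)]
  -- the staircase Stokes identity at `L = 1`
  have hst := stair_stokes φ κ 1 lw (List.finRange d).reverse (q + u)
  have hsw : stairWord (d := d) lw (List.finRange d).reverse = treeWord v := (treeWord_natCast_eq_stairWord lw).symm
  rw [hsw, disp_treeWord, asum_seg_one, asum_seg_one, Nat.cast_one, one_smul] at hst
  -- assemble
  unfold dPot
  simp only []
  rw [hpot2, hpot1]
  have hx : (q + fun i => ((w i : ℕ) : ℤ)) = q + u + v := by rw [huv]; abel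
  rw [hx, ← hst]
  abel

/-! ## §3 The size of a ladder -/

omit [Fintype n] [DecidableEq n] in
/-- `(p + c•e_m)_m = p_m + c`. [folklore] -/
theorem add_zsmul_e_self (p : Site d) (c : ℤ) (m : Fin d) : (p + c • e m) m = p m + c := by
  simp [e_apply]

omit [Fintype n] [DecidableEq n] in
/-- `(p + c•e_m)_j = p_j` for `j ≠ m`. [folklore] -/
theorem add_zsmul_e_ne (p : Site d) (c : ℤ) {m j : Fin d} (h : j ≠ m) : (p + c • e m) j = p j := by
  simp [e_apply, h]

/-- **`‖stairSum φ κ 1 lw p ms‖ ≤ (Σ_{m∈ms} lw_m)·G`** whenever every plaquette circulation `φ(∂p_{m,κ}(y))` with `q ≤ y ≤ x` (coordinatewise) is `≤ G`, for a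
duplicate-free axis list `ms` and a base point `p ≥ q` with `p_i + [i ∈ ms]·lw_i ≤ x_i` (the staircase stays in the box `[q, x]`). [folklore] -/
theorem norm_stairSum_one_le (φ : Site d → Fin d → Matrix n n ℂ) (κ : Fin d) (lw : Fin d → ℕ) (q x : Site d) {G : ℝ} (hG0 : 0 ≤ G)
    (hG : ∀ y : Site d, (∀ i, q i ≤ y i ∧ y i ≤ x i) → ∀ m : Fin d, ‖asum φ y (plaqWord m κ)‖ ≤ G) :
    ∀ (ms : List (Fin d)), ms.Nodup → ∀ (p : Site d), (∀ i, q i ≤ p i) → (∀ i, p i + (if i ∈ ms then ((lw i : ℕ) : ℤ) else 0) ≤ x i) →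
      ‖stairSum φ κ 1 lw p ms‖ ≤ (((ms.map lw).sum : ℕ) : ℝ) * G
  | [], _, p, _, _ => by simp
  | m :: ms, hnd, p, hqp, hpx => by
    classical
    have hm : m ∉ ms := (List.nodup_cons.mp hnd).1
    have hnd' : ms.Nodup := (List.nodup_cons.mp hnd).2
    have hpm : p m + ((lw m : ℕ) : ℤ) ≤ x m := by
      have h := hpx m
      rwa [if_pos List.mem_cons_self] at h
    have hpx' : ∀ i, p i ≤ x i := fun i => by
      have h := hpx i
      have h0 : (0 : ℤ) ≤ if i ∈ m :: ms then ((lw i : ℕ) : ℤ) else 0 := by split_ifs <;> positivity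
      linarith
    rw [stairSum_cons, List.map_cons, List.sum_cons, Nat.cast_add, add_mul]
    refine (norm_add_le _ _).trans (add_le_add ?_ ?_)
    · -- the rectangle of `lw m` plaquettes along `e_m` from `p`
      refine (norm_sum_le _ _).trans ?_
      calc ∑ i ∈ range (lw m), ‖∑ j ∈ range 1, asum φ (p + (i : ℤ) • e m + (j : ℤ) • e κ) (plaqWord m κ)‖
          ≤ ∑ _i ∈ range (lw m), G := by
            refine Finset.sum_le_sum fun i hi => ?_
            have hi' : ((i : ℕ) : ℤ) < lw m := by exact_mod_cast Finset.mem_range.mp hi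
            have hi0 : (0 : ℤ) ≤ i := Int.natCast_nonneg i
            rw [Finset.sum_range_one, Nat.cast_zero, zero_smul, add_zero]
            refine hG _ (fun j => ?_) m
            by_cases hj : j = m
            · rw [hj, add_zsmul_e_self]
              constructor <;> linarith [hqp m]
            · rw [add_zsmul_e_ne p _ hj]
              exact ⟨hqp j, hpx' j⟩
        _ = ((lw m : ℕ) : ℝ) * G := by rw [Finset.sum_const, Finset.card_range, nsmul_eq_mul]
    · -- the rest of the staircase, from `p + lw_m e_m`
      refine norm_stairSum_one_le φ κ lw q x hG0 hG ms hnd' _ (fun i => ?_) (fun i => ?_)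
      · by_cases hi : i = m
        · rw [hi, add_zsmul_e_self]
          have : (0 : ℤ) ≤ ((lw m : ℕ) : ℤ) := by positivity
          linarith [hqp m]
        · rw [add_zsmul_e_ne p _ hi]; exact hqp i
      · by_cases hi : i = m
        · rw [hi, add_zsmul_e_self, if_neg hm, add_zero]
          exact hpm
        · rw [add_zsmul_e_ne p _ hi]
          have h := hpx i
          have hmem : (i ∈ m :: ms) ↔ (i ∈ ms) := by simp [List.mem_cons, hi]
          simp only [hmem] at h
          exact h

/-! ## §4 The Poincaré bound -/

/-- **SUP-NORM POINCARÉ LEMMA ON A BOX (axial gauge)**: for `x = q + w` (`w ≥ 0`) and `G` a bound of the plaquette circulations `‖φ(∂p_{m,κ}(y))‖` over the base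
points `q ≤ y ≤ x`, the tree potential `λ = φ(Γ_{q,·})` has `‖φ(x,κ) − dPot λ (x,κ)‖ ≤ |w|₁·G`. [folklore] -/
theorem norm_sub_dPot_treePot_le (φ : Site d → Fin d → Matrix n n ℂ) (q : Site d) (w : Fin d → ℕ) (κ : Fin d) {G : ℝ} (hG0 : 0 ≤ G)
    (hG : ∀ y : Site d, (∀ i, q i ≤ y i ∧ y i ≤ q i + w i) → ∀ m : Fin d, ‖asum φ y (plaqWord m κ)‖ ≤ G) :
    ‖φ (q + fun i => ((w i : ℕ) : ℤ)) κ - dPot (fun y : Site d => asum φ q (treeWord (y - q))) (q + fun i => ((w i : ℕ) : ℤ)) κ‖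
      ≤ (∑ i, (w i : ℝ)) * G := by
  classical
  rw [sub_dPot_treePot_eq_stairSum]
  have hnd : ((List.finRange d).reverse).Nodup := List.nodup_reverse.mpr (List.nodup_finRange d)
  have h := norm_stairSum_one_le φ κ (fun i => if i < κ then w i else 0) q (q + fun i => ((w i : ℕ) : ℤ)) hG0
    (fun y hy m => hG y (fun i => by have := hy i; simpa using this) m) _ hnd
    (q + fun i => if κ ≤ i then ((w i : ℕ) : ℤ) else 0)
    (fun i => by
      simp only [Pi.add_apply]
      split_ifs <;> simp)
    (fun i => by
      simp only [Pi.add_apply, List.mem_reverse, List.mem_finRange, if_true]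
      by_cases h : κ ≤ i
      · rw [if_pos h, if_neg (not_lt.mpr h)]; simp
      · rw [if_neg h, if_pos (not_le.mp h)]; simp)
  refine h.trans (mul_le_mul_of_nonneg_right ?_ hG0)
  -- `Σ_{m} [m<κ] w_m ≤ Σ_i w_i`
  have hsum : (((List.finRange d).reverse.map (fun i => if i < κ then w i else 0)).sum : ℕ) ≤ ∑ i, w i := by
    rw [← List.sum_toFinset _ hnd]
    exact (Finset.sum_le_sum_of_subset (Finset.subset_univ _)).trans (Finset.sum_le_sum fun i _ => by split_ifs <;> omega)
  calc ((((List.finRange d).reverse.map (fun i => if i < κ then w i else 0)).sum : ℕ) : ℝ) ≤ ((∑ i, w i : ℕ) : ℝ) := by exact_mod_cast hsum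
    _ = ∑ i, (w i : ℝ) := by push_cast; rfl

end

end Summit.QuantumFields.BalabanUV.T4Continuum.NE7CoarseAxialPoincare
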